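import Literature.Geometry.Kaehler.LefschetzPointwise
import HarnessLib

/-!
# Wedge calculus for the pointwise Hodge–Riemann relation: the shuffle wedge against `1`-forms
# and complex conjugation

Topic `Literature/LinearAlgebra/Alternating`. Algebraic bookkeeping used by the pointwise
Hodge–Riemann bilinear relation (`Literature/Geometry/Kaehler/HodgeRiemannPointwise*`; C. Voisin,
*Hodge Theory and Complex Algebraic Geometry I* (2002), §6.3.2; D. Huybrechts, *Complex Geometry*
(2005), Cor. 1.2.36), relating the three products of the tree on continuous alternating maps of a
real normed space `V` with values in a normed commutative `ℝ`-algebra `A` (`A = ℂ` for the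
conjugation lemmas):

* the shuffle wedge `ContinuousAlternatingMap.wedge` (`FormsAlgebra`, Warner's normalisation),
* the wedge `wedgeOne θ η = θ ∧ η` with a constant real `1`-form (`WedgeOne`, CAR calculus),
* complex conjugation `conjForm` of `ℂ`-valued forms (the fibrewise operation of `MForm.conj`).

Main statements (all proved; Warner (1983), 2.6: the exterior algebra is associative and graded
commutative):

* `wedge_wedgeOne`: `η ∧ (θ ∧ ψ) = (-1)^k θ ∧ (η ∧ ψ)` for a `k`-form `η` (from the pointwise
  Leibniz half `alternatizeUncurryFin_wedge_right`), hence `wedge_wedgeOne_wedgeOne`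
  (`η ∧ (θ ∧ θ' ∧ ψ) = θ ∧ θ' ∧ (η ∧ ψ)`: pairs of covectors are central); with the tree's
  `wedgeOne_wedge_eq` (`(θ ∧ η) ∧ ψ = θ ∧ (η ∧ ψ)`), `wedgeOne_wedgeOne_wedge`;
* conjugation: `conj (α ∧ β) = conj α ∧ conj β`, `conj (θ ∧ η) = θ ∧ conj η` (real `θ`),
  `conj (w ⌟ η) = w ⌟ conj η`, conjugate-linearity; complex scalars pass through `∧` and `θ ∧ ·`;
* reindexing (`domDomCongr` along equations of degrees) commutes with all of the above.

The graded (all-degrees) packaging of these operations, in which the Lefschetz operators and the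
interior products become honest endomorphisms, is `GradedForms.lean`.

## References

* F. W. Warner, *Foundations of Differentiable Manifolds and Lie Groups*, GTM 94 (1983), 2.6,
  2.10, 2.11. [Warner1983]
* C. Voisin, *Hodge Theory and Complex Algebraic Geometry I*, CUP (2002), §6.2.1, §6.3.2. [Voisin2002]
* D. Huybrechts, *Complex Geometry. An Introduction* (2005), §1.2. [Huybrechts2005]
-/

noncomputable section

open ContinuousAlternatingMap Function
open Literature.Geometry.Kaehler (wedgeOne_wedge_eq wedgeOne_domDomCongr_finCongr
  domDomCongr_finCongr_trans domDomCongr_finCongr_self sum_wedge_left domDomCongr_sum)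

namespace Literature.LinearAlgebra.Alternating

variable {V : Type*} [NormedAddCommGroup V] [NormedSpace ℝ V]
  {A : Type*} [NormedCommRing A] [NormedAlgebra ℝ A]

/-! ### Reindexing along equations of degrees -/

section Cast

variable {F : Type*} [NormedAddCommGroup F] [NormedSpace ℝ F] {k k' l l' : ℕ}

/-- Reindexing is injective: `η.cast h = ψ.cast h ↔ η = ψ`. [folklore] -/
theorem domDomCongr_finCongr_inj (h : k = k') {η ψ : V [⋀^Fin k]→L[ℝ] F} :
    η.domDomCongr (finCongr h) = ψ.domDomCongr (finCongr h) ↔ η = ψ := by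
  subst h; exact Iff.rfl

/-- Reindexing commutes with scalars. [folklore] -/
theorem domDomCongr_finCongr_smul {R : Type*} [Monoid R] [DistribMulAction R F]
    [ContinuousConstSMul R F] [SMulCommClass ℝ R F] (h : k = k') (c : R)
    (η : V [⋀^Fin k]→L[ℝ] F) :
    (c • η).domDomCongr (finCongr h) = c • η.domDomCongr (finCongr h) := by
  subst h; rfl

/-- Reindexing commutes with negation. [folklore] -/
theorem domDomCongr_finCongr_neg (h : k = k') (η : V [⋀^Fin k]→L[ℝ] F) :
    (-η).domDomCongr (finCongr h) = -η.domDomCongr (finCongr h) := by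
  subst h; rfl

/-- Reindexing commutes with subtraction. [folklore] -/
theorem domDomCongr_finCongr_sub (h : k = k') (η ψ : V [⋀^Fin k]→L[ℝ] F) :
    (η - ψ).domDomCongr (finCongr h) = η.domDomCongr (finCongr h) - ψ.domDomCongr (finCongr h) := by
  subst h; rfl

/-- Reindexing of `0`. [folklore] -/
theorem domDomCongr_finCongr_zero (h : k = k') :
    (0 : V [⋀^Fin k]→L[ℝ] F).domDomCongr (finCongr h) = 0 := by
  subst h; rfl

/-- A reindexed form vanishes iff the form does. [folklore] -/
theorem domDomCongr_finCongr_eq_zero_iff (h : k = k') {η : V [⋀^Fin k]→L[ℝ] F} :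
    η.domDomCongr (finCongr h) = 0 ↔ η = 0 := by
  subst h; exact Iff.rfl

/-- Reindexing commutes with post-composition by a continuous linear map. [folklore] -/
theorem compContinuousAlternatingMap_domDomCongr_finCongr {G : Type*} [NormedAddCommGroup G]
    [NormedSpace ℝ G] (g : F →L[ℝ] G) (h : k = k') (η : V [⋀^Fin k]→L[ℝ] F) :
    g.compContinuousAlternatingMap (η.domDomCongr (finCongr h)) =
      (g.compContinuousAlternatingMap η).domDomCongr (finCongr h) := by
  subst h; rfl

/-- Reindexing commutes with precomposition by a continuous linear map. [folklore] -/
theorem domDomCongr_finCongr_compContinuousLinearMap {W : Type*} [NormedAddCommGroup W]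
    [NormedSpace ℝ W] (T : W →L[ℝ] V) (h : k = k') (η : V [⋀^Fin k]→L[ℝ] F) :
    (η.domDomCongr (finCongr h)).compContinuousLinearMap T =
      (η.compContinuousLinearMap T).domDomCongr (finCongr h) := by
  subst h; rfl

/-- Reindexing the left factor of a shuffle wedge. [folklore] -/
theorem domDomCongr_finCongr_wedge (h : k = k') (η : V [⋀^Fin k]→L[ℝ] A) (ψ : V [⋀^Fin l]→L[ℝ] A) :
    (η.domDomCongr (finCongr h)).wedge ψ =
      (η.wedge ψ).domDomCongr (finCongr (congrArg (· + l) h)) := by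
  subst h; rfl

/-- Reindexing the right factor of a shuffle wedge. [folklore] -/
theorem wedge_domDomCongr_finCongr (h : l = l') (η : V [⋀^Fin k]→L[ℝ] A) (ψ : V [⋀^Fin l]→L[ℝ] A) :
    η.wedge (ψ.domDomCongr (finCongr h)) =
      (η.wedge ψ).domDomCongr (finCongr (congrArg (k + ·) h)) := by
  subst h; rfl

/-- Interior product of a reindexed form. [folklore] -/
theorem curryLeft_domDomCongr_finCongr (h : k = k') (η : V [⋀^Fin (k + 1)]→L[ℝ] F) (w : V) :
    (η.domDomCongr (finCongr (congrArg (· + 1) h))).curryLeft w =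
      (η.curryLeft w).domDomCongr (finCongr h) := by
  subst h; rfl

end Cast

/-! ### The shuffle wedge against a wedge with a `1`-form -/

section WedgeOne

variable {k l : ℕ}

/-- **`η ∧ (θ ∧ ψ) = (-1)^k θ ∧ (η ∧ ψ)`** for a `k`-form `η`, a real `1`-form `θ` and an `l`-form
`ψ` (graded commutativity, Warner (1983), 2.6; from the pointwise Leibniz half
`alternatizeUncurryFin_wedge_right`). [cite: Warner1983, 2.6] -/
theorem wedge_wedgeOne (η : V [⋀^Fin k]→L[ℝ] A) (θ : V →L[ℝ] ℝ) (ψ : V [⋀^Fin l]→L[ℝ] A) :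
    η.wedge (wedgeOne θ ψ) = ((-1 : ℝ) ^ k) • wedgeOne θ (η.wedge ψ) := by
  have h := Literature.NumberTheory.Transcendental.alternatizeUncurryFin_wedge_right
    (θ.smulRight (η.wedge ψ)) η (θ.smulRight ψ)
    (fun v ↦ by simp [ContinuousAlternatingMap.wedge_smul_right])
  change wedgeOne θ (η.wedge ψ) = ((-1 : ℝ) ^ k) • η.wedge (wedgeOne θ ψ) at h
  rw [h, smul_smul, ← mul_pow, neg_one_mul, neg_neg, one_pow, one_smul]

/-- `η ∧ (θ ∧ θ' ∧ ψ) = θ ∧ θ' ∧ (η ∧ ψ)` (two covectors pass a `k`-form with sign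
`(-1)^{2k} = 1`). [cite: Warner1983, 2.6] -/
theorem wedge_wedgeOne_wedgeOne (η : V [⋀^Fin k]→L[ℝ] A) (θ θ' : V →L[ℝ] ℝ)
    (ψ : V [⋀^Fin l]→L[ℝ] A) :
    η.wedge (wedgeOne θ (wedgeOne θ' ψ)) = wedgeOne θ (wedgeOne θ' (η.wedge ψ)) := by
  rw [wedge_wedgeOne, wedge_wedgeOne, wedgeOne_smul, smul_smul, ← mul_pow, neg_one_mul, neg_neg,
    one_pow, one_smul]

/-- `(θ ∧ θ' ∧ η) ∧ ψ = θ ∧ θ' ∧ (η ∧ ψ)`, up to the reindexing `k + l + 2 = k + 2 + l`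
(associativity, Warner (1983), 2.6; the tree's `wedgeOne_wedge_eq` twice). [cite: Warner1983, 2.6] -/
theorem wedgeOne_wedgeOne_wedge (θ θ' : V →L[ℝ] ℝ) (η : V [⋀^Fin k]→L[ℝ] A)
    (ψ : V [⋀^Fin l]→L[ℝ] A) :
    (wedgeOne θ (wedgeOne θ' η)).wedge ψ =
      (wedgeOne θ (wedgeOne θ' (η.wedge ψ))).domDomCongr
        (finCongr (show k + l + 2 = k + 2 + l by omega)) := by
  rw [wedgeOne_wedge_eq, wedgeOne_wedge_eq, wedgeOne_domDomCongr_finCongr, domDomCongr_finCongr_trans]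

end WedgeOne

/-! ### Complex conjugation of complex-valued forms -/

section Conj

variable {k l : ℕ}

/-- **Complex conjugation of a complex-valued form** on a real normed space, `η̄(v) = conj (η v)`
(post-composition with the real-linear `Complex.conjCLE`; the fibrewise operation of the tree's
`MForm.conj`). Voisin (2002), §2.3.1. [cite: Voisin2002, §2.3.1] -/
def conjForm (η : V [⋀^Fin k]→L[ℝ] ℂ) : V [⋀^Fin k]→L[ℝ] ℂ :=
  (Complex.conjCLE : ℂ →L[ℝ] ℂ).compContinuousAlternatingMap η

/-- Unfolding of `conjForm` (definitional). [folklore] -/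
theorem conjForm_eq (η : V [⋀^Fin k]→L[ℝ] ℂ) :
    conjForm η = (Complex.conjCLE : ℂ →L[ℝ] ℂ).compContinuousAlternatingMap η := rfl

/-- Pointwise formula for the conjugate form. [folklore] -/
@[simp]
theorem conjForm_apply (η : V [⋀^Fin k]→L[ℝ] ℂ) (v : Fin k → V) :
    conjForm η v = starRingEnd ℂ (η v) := rfl

/-- Conjugation commutes with reindexing. [folklore] -/
theorem conjForm_domDomCongr_finCongr {k' : ℕ} (h : k = k') (η : V [⋀^Fin k]→L[ℝ] ℂ) :
    conjForm (η.domDomCongr (finCongr h)) = (conjForm η).domDomCongr (finCongr h) := by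
  subst h; rfl

/-- Conjugation of forms is involutive. [folklore] -/
@[simp]
theorem conj_conj (η : V [⋀^Fin k]→L[ℝ] ℂ) : conjForm (conjForm η) = η := by
  ext v; simp

/-- Conjugation of forms is additive. [folklore] -/
theorem conj_add (η ψ : V [⋀^Fin k]→L[ℝ] ℂ) : conjForm (η + ψ) = conjForm η + conjForm ψ := by
  ext v; simp

/-- Conjugation of forms commutes with subtraction. [folklore] -/
theorem conj_sub (η ψ : V [⋀^Fin k]→L[ℝ] ℂ) : conjForm (η - ψ) = conjForm η - conjForm ψ := by
  ext v; simp

/-- Conjugation of forms commutes with negation. [folklore] -/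
theorem conj_neg (η : V [⋀^Fin k]→L[ℝ] ℂ) : conjForm (-η) = -conjForm η := by
  ext v; simp

/-- Conjugation of the zero form. [folklore] -/
@[simp]
theorem conj_zero : conjForm (0 : V [⋀^Fin k]→L[ℝ] ℂ) = 0 := by
  ext v; simp

/-- Conjugation of forms is conjugate-linear. [folklore] -/
theorem conj_smul (c : ℂ) (η : V [⋀^Fin k]→L[ℝ] ℂ) : conjForm (c • η) = starRingEnd ℂ c • conjForm η := by
  ext v; simp

/-- Conjugation of forms commutes with real scalars. [folklore] -/
theorem conj_smul_real (c : ℝ) (η : V [⋀^Fin k]→L[ℝ] ℂ) : conjForm (c • η) = c • conjForm η := by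
  ext v; simp

/-- Conjugation of forms commutes with finite sums. [folklore] -/
theorem conj_sum {ι : Type*} (s : Finset ι) (η : ι → V [⋀^Fin k]→L[ℝ] ℂ) :
    conjForm (∑ i ∈ s, η i) = ∑ i ∈ s, conjForm (η i) := by
  ext v; simp

/-- A form vanishes iff its conjugate does. [folklore] -/
theorem conj_eq_zero_iff {η : V [⋀^Fin k]→L[ℝ] ℂ} : conjForm η = 0 ↔ η = 0 := by
  refine ⟨fun h ↦ ?_, fun h ↦ by rw [h, conj_zero]⟩
  rw [← conj_conj η, h, conj_zero]

/-- **Conjugation is multiplicative for the shuffle wedge**: `conj (η ∧ ψ) = conj η ∧ conj ψ`.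
[folklore] -/
theorem conj_wedge (η : V [⋀^Fin k]→L[ℝ] ℂ) (ψ : V [⋀^Fin l]→L[ℝ] ℂ) :
    conjForm (η.wedge ψ) = (conjForm η).wedge (conjForm ψ) := by
  ext v
  simp only [conjForm_apply, ContinuousAlternatingMap.wedge_apply, Complex.real_smul, map_mul,
    Complex.conj_ofReal, _root_.map_sum, Units.smul_def, zsmul_eq_mul, map_intCast]

/-- Conjugation commutes with the wedge by a real covector: `conj (θ ∧ η) = θ ∧ conj η`. [folklore] -/
theorem conj_wedgeOne (θ : V →L[ℝ] ℝ) (η : V [⋀^Fin k]→L[ℝ] ℂ) :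
    conjForm (wedgeOne θ η) = wedgeOne θ (conjForm η) := by
  ext v
  simp [wedgeOne_apply, conjForm_apply]

/-- Conjugation commutes with the interior product. [folklore] -/
theorem conj_curryLeft (η : V [⋀^Fin (k + 1)]→L[ℝ] ℂ) (w : V) :
    conjForm (η.curryLeft w) = (conjForm η).curryLeft w := by
  ext v; simp

/-- The shuffle wedge of complex-valued forms on a real space commutes with complex scalars on the
left. [folklore] -/
theorem wedge_smul_left_complex (c : ℂ) (η : V [⋀^Fin k]→L[ℝ] ℂ) (ψ : V [⋀^Fin l]→L[ℝ] ℂ) :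
    (c • η).wedge ψ = c • η.wedge ψ := by
  ext v
  simp only [ContinuousAlternatingMap.wedge_apply, ContinuousAlternatingMap.smul_apply, smul_eq_mul,
    Finset.mul_sum, Finset.smul_sum]
  refine Finset.sum_congr rfl fun σ _ ↦ ?_
  simp only [Units.smul_def, zsmul_eq_mul, Complex.real_smul]
  ring

/-- The shuffle wedge of complex-valued forms on a real space commutes with complex scalars on the
right. [folklore] -/
theorem wedge_smul_right_complex (c : ℂ) (η : V [⋀^Fin k]→L[ℝ] ℂ) (ψ : V [⋀^Fin l]→L[ℝ] ℂ) :
    η.wedge (c • ψ) = c • η.wedge ψ := by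
  ext v
  simp only [ContinuousAlternatingMap.wedge_apply, ContinuousAlternatingMap.smul_apply, smul_eq_mul,
    Finset.mul_sum, Finset.smul_sum]
  refine Finset.sum_congr rfl fun σ _ ↦ ?_
  simp only [Units.smul_def, zsmul_eq_mul, Complex.real_smul]
  ring

/-- The wedge by a real covector commutes with complex scalars. (Same statement as
`Literature.Geometry.Kaehler.wedgeOne_real_smul_complex` of `KaehlerSymbolIdentityProofs`, whose
import cone — the Hodge star and the Kähler symbol calculus — is deliberately not pulled into this
linear-algebra layer.) [folklore] -/
theorem wedgeOne_smul_complex (ξ : V →L[ℝ] ℝ) (c : ℂ) (η : V [⋀^Fin k]→L[ℝ] ℂ) :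
    wedgeOne ξ (c • η) = c • wedgeOne ξ η := by
  ext v
  simp only [wedgeOne_apply, ContinuousAlternatingMap.smul_apply, smul_eq_mul, Finset.mul_sum]
  exact Finset.sum_congr rfl fun i _ ↦ by rw [Complex.real_smul, Complex.real_smul]; ring

end Conj

end Literature.LinearAlgebra.Alternating

end
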